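import Literature.NumberTheory.DiophantineGeometry.PowerTraceStabilizer
import Literature.NumberTheory.DiophantineGeometry.WordModelProjection
import HarnessLib

/-!
# Gesmundo–Ikenmeyer–Panova's Thm. 8 inequality `t_λ ≤ sm(λ) = Σ_μ sk(λ, μ)` for the orbit
# closure of the matrix power trace, occurrence form (proved)

Gesmundo–Ikenmeyer–Panova, *Geometric complexity theory and matrix powering* (2017), Thm. 8:
"For `n, m ≥ 3` we have `ℂ[GL_{n²} Pow^m_n]_d = ℂ[GL_{n²}]^𝒮_d = ⊕_λ V_λ^{⊕ sm(λ,n)}`, where the sum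
is over all `λ ⊢ md` and `sm(λ, n) := Σ_{μ ⊢_n dm} sk(λ, μ)`", whence "`t_{λ,n}(d[m]) ≤ sm(λ, n)`"
(the multiplicity in the coordinate ring of the orbit CLOSURE is at most that of the orbit), and
Thm. 24: `dim [𝕊_πV]^𝒮 = sm(π, n) = Σ_{μ ⊢ d, ℓ(μ) ≤ n} sk(π, μ)` with
`sk(π, μ) = dim Hom_{𝔖_d}([π], S²[μ])`. This file PROVES the consequence that the barrier file
`Literature.Barriers.ValiantsHypothesis.GCTMatrixPowering` consumes (its Cor. 9), over any field
`k` of characteristic zero and in the tree's letters (matrix size `m`, exponent `n`,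
`D = |λ|`):

* `exists_sum_ne_zero_of_hasHighestWeight_powFormLex`: if the dual weight `λ*` of a partition
  `λ ⊢ D` with at most `m²` parts occurs in `k[\overline{GL_{m²} · tr(X^n)}]` (degree-`n`
  coordinates, `orbitCoordRep (powFormLex k m n) n`, any `n`), then for some `μ ⊢ D` with at most
  `m` parts `∑_{τ ∈ 𝔖_D} χ^λ(τ) (χ^μ(τ)² + χ^μ(τ²)) ≠ 0` — i.e. `2 · D! · sk(λ, μ) ≠ 0`,
  `sm(λ, m) > 0`.

## Proof (an upper bound needs neither Peter–Weyl nor the full stabilizer)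

With the BLMW-bound machinery of `SchurWeylPlethysmKroneckerBoundProofs` (`orbitCoordToPoly`,
`exists_mem_boundSpace`, `boundSpace`, `sliceRep`): a nonzero `B`-semi-invariant class of weight
`λ*` in `k[Δ_n(Pow)]` yields a nonzero `𝔖_D`-invariant coefficient matrix `L` on `W`-words
(`W = E ⊗ F = k^{m²}`) whose columns lie in the transposed weight space `Y` of `λ*` (character
`χ^λ`, `character_transposedPermRep_dualOfPartition`) and whose rows are fixed by the stabilizing
family `S = {a ⊗ (a⁻¹)ᵀ} ∪ {swap}` of `tr(X^n)` (`PowerTraceStabilizer`; `powFixed`,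
`exists_mem_boundSpace_ne_zero`). A nonzero row `r` has a nonzero symmetric `GL_m`-commuting
matrix `M = splitMat r` (`isGLCommuting_splitMat_of_fixed`, `splitMat_transpose_of_swap_fixed`),
which moves some `HW_μ` (`IsGLCommuting.exists_mulVec_ne_zero`, `WordModelSelfDuality`); the
slice matrices `N_{M_I} = M_I Π_μ` of all rows (`WordModelProjection`) assemble into a nonzero
`𝔖_D`-invariant element of `sliceRep` on `Y ⊗ symSlice(HW_μ)`, so
`D! · dim (Y ⊗ Sym²HW_μ)^{𝔖_D} = ∑_τ χ^λ(τ) χ_{Sym²}(τ) ≠ 0` (`card_mul_finrank_invariants_sliceRep`)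
and `2 χ_{Sym²HW_μ}(τ) = χ^μ(τ)² + χ^μ(τ²)` (`two_mul_character_symSlice`, `character_hwPermRep`).
This is GIP's computation of `[𝕊_πV]^𝒮` (Prop. 22, Lemma 23, Thm. 24) run as an INEQUALITY on
the subfamily `S` of the stabilizer, which suffices for `t_λ ≤ sm(λ)`-type conclusions; equality
(Thm. 8 itself, via the algebraic Peter–Weyl theorem and the full stabilizer Thm. 7) is not
claimed.

## References

* F. Gesmundo, C. Ikenmeyer, G. Panova, Diff. Geom. Appl. 55 (2017) 106–127 = arXiv:1611.00827
  (held, `lit read`): §2.1 (`sk`), §2.2 (Thm. 7, Thm. 8, "`t_{λ,n}(d[m]) ≤ sm(λ, n)`", Cor. 9),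
  §4 (Prop. 22, Lemma 23, Thm. 24). [GesmundoIkenmeyerPanova2017]
* P. Bürgisser, J. M. Landsberg, L. Manivel, J. Weyman, SIAM J. Comput. 40 (2011), §5.2
  Prop. 5.2.1 (the determinant analogue, tree: `orbitMultiplicity_det_le_kroneckerCoeff_holds`).
  [BLMW2011]
* W. Fulton, J. Harris, GTM 129, §2.1 Ex. 2.2, §2.2 (2.9), Lemma 6.23. [FultonHarrisGTM129]

## Design

`namespace Literature.NumberTheory.DiophantineGeometry`. The conclusion is stated as the raw
character sum (the barrier file's `skCharSum`/`SkPos`/`SmPos` over `ℂ` unfold to it), so that this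
file does not import the barrier catalogue.
-/

noncomputable section

open scoped BigOperators Matrix Kronecker
open MvPolynomial

namespace Literature.NumberTheory.DiophantineGeometry

section Bound

variable (k : Type*) [Field k] (m : ℕ)

/-- The stabilizing family used: the conjugations `a ⊗ (a⁻¹)ᵀ`, `a ∈ GL_m`, and the transposition
`swapGL` (generators of the stabilizer of `Pow^n_m` modulo roots of unity, GIP Thm. 7; only
"these elements stabilise" is used). [cite: GesmundoIkenmeyerPanova2017, Thm. 7] -/
def IsPowStab (h : GL (Fin (m * m)) k) : Prop :=
  (∃ a : GL (Fin m) k, h = kronFin k m a (transposeGL k a⁻¹)) ∨ h = swapGL k m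

/-- The vectors of `W^{⊗D}`, `W = k^{m²}`, fixed by the stabilizing family (they contain the
`𝒮`-invariants of GIP Thm. 24). [cite: GesmundoIkenmeyerPanova2017, §4 Thm. 24] -/
def powFixed (D : ℕ) : Submodule k (Word (m * m) D → k) where
  carrier := {x | ∀ h, IsPowStab k m h → wordRep k (m * m) D h x = x}
  add_mem' {x y} hx hy h hh := by rw [map_add, hx h hh, hy h hh]
  zero_mem' h _ := by rw [map_zero]
  smul_mem' c {x} hx h hh := by rw [map_smul, hx h hh]

variable {k m}

/-- Membership in `powFixed` (unfolding lemma). [folklore] -/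
theorem mem_powFixed_iff {D : ℕ} (x : Word (m * m) D → k) :
    x ∈ powFixed k m D ↔ ∀ h, IsPowStab k m h → wordRep k (m * m) D h x = x :=
  Iff.rfl

/-- The matrix of a fixed vector commutes with `GL_m`. [cite: GesmundoIkenmeyerPanova2017, §4 Prop. 22 (proof)] -/
theorem isGLCommuting_splitMat_of_mem_powFixed {D : ℕ} {x : Word (m * m) D → k}
    (hx : x ∈ powFixed k m D) : IsGLCommuting k (splitMat x) :=
  isGLCommuting_splitMat_of_fixed fun a => hx _ (Or.inl ⟨a, rfl⟩)

/-- The matrix of a fixed vector is symmetric. [cite: GesmundoIkenmeyerPanova2017, §4 Lemma 23] -/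
theorem splitMat_transpose_of_mem_powFixed {D : ℕ} {x : Word (m * m) D → k}
    (hx : x ∈ powFixed k m D) : (splitMat x)ᵀ = splitMat x :=
  splitMat_transpose_of_swap_fixed (hx _ (Or.inr rfl))

/-- **A nonzero element of the bound space** (occurrence form of
`finrank_highestWeightSpace_orbitCoordRep_le`): if `χ` (with `∑ χ = -D`) occurs in `k[Δ_m[f]]`
then the bound space `T = boundSpace (χ ∘ e) X` of `𝔖_D`-invariant coefficient matrices with
columns in the transposed weight space and rows in any `X` containing the vectors fixed by a
stabilizing family `S` is nonzero — the injection `HW_χ(k[Δ_m[f]]) ↪ k[Mat]` (`hwToPoly`,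
`transportPoly`) lands in `pairPoly(T)` (`exists_mem_boundSpace`). BLMW 2011 §5.2
("`mult_π ℂ[\overline{GL·x}]_δ ≤ dim (S_πW)^{H}`"). [cite: BLMW2011, §5.2 Prop. 5.2.1] -/
theorem exists_mem_boundSpace_ne_zero [CharZero k] {σ : Type*} [Fintype σ] [LinearOrder σ]
    (f : MvPolynomial σ k) (mdeg : ℕ) (χ : Weight σ) {N D : ℕ} (e : Fin N ≃o σ)
    (hsize : χ.size = -(D : ℤ)) (X : Submodule k (Word N D → k)) (S : GL (Fin N) k → Prop)
    (hSX : ∀ x : Word N D → k, (∀ h, S h → wordRep k N D h x = x) → x ∈ X)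
    (hSf : ∀ h, S h →
      Literature.Computability.AlgebraicComplexity.linSubstRep σ k (reindexGL e h) f = f)
    (hχ : HasHighestWeight (Literature.Computability.AlgebraicComplexity.orbitCoordRep f mdeg) χ) :
    ∃ L ∈ boundSpace k (χ ∘ e) X, L ≠ 0 := by
  obtain ⟨x, hx0, hx⟩ := (hasHighestWeight_iff_exists _ _).mp hχ
  obtain ⟨F, hF⟩ := Ideal.Quotient.mk_surjective x
  have hxF : Ideal.Quotient.mk _ F ∈
      highestWeightSpace (Literature.Computability.AlgebraicComplexity.orbitCoordRep f mdeg) χ := by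
    rw [hF]; exact hx
  obtain ⟨L, hL, hLP⟩ := exists_mem_boundSpace k (χ := χ ∘ e) (X := X)
    (transportPoly e (orbitCoordToPoly f mdeg (Ideal.Quotient.mk _ F)))
    (isHomogeneous_transportPoly e (isHomogeneous_orbitCoordToPoly f mdeg hxF hsize))
    (eval_transportPoly_mul_left e _ χ fun b hb g => eval_orbitCoordToPoly_mul_left f mdeg hxF hb g)
    S hSX
    (fun h hh => eval_transportPoly_mul_right e _ h fun g =>
      eval_orbitCoordToPoly_mul_right f mdeg F (hSf h hh) g)
  refine ⟨L, hL, fun hL0 => hx0 ?_⟩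
  rw [hL0, map_zero] at hLP
  have h1 : orbitCoordToPoly f mdeg (Ideal.Quotient.mk _ F) = 0 :=
    transportPoly_injective e (by rw [← hLP, map_zero])
  rw [← hF]
  exact orbitCoordToPoly_injective f mdeg (by rw [h1, map_zero])

/-- The size of the transported dual weight `λ*` of `λ ⊢ D` (at most `m²` parts) is `-D` (as
`size_toMatIdx_dualOfPartition`, for an arbitrary degree `D`). [folklore] -/
theorem size_toMatIdx_dualOfPartition' {D : ℕ} (lam : Nat.Partition D)
    (hlam : lam.parts.card ≤ m * m) :
    ((Weight.dualOfPartition (m * m) lam).toMatIdx : Weight (MatIdx m)).size = -(D : ℤ) := by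
  have hsize : ((Weight.dualOfPartition (m * m) lam).toMatIdx : Weight (MatIdx m)).size =
      (Weight.dualOfPartition (m * m) lam).size := by
    unfold Weight.size
    exact Fintype.sum_equiv (matIdxEquiv m).symm.toEquiv _ _ fun _ => rfl
  rw [hsize, Weight.dualOfPartition, Weight.size_dual, Weight.size_ofPartition_holds hlam]

variable (k) in
/-- The simultaneous action of `𝔖_D` on functions of an `N`-word and a pair of `N'`-words
(coordinate formula for `pairRep wordPermRep (pairRep wordPermRep wordPermRep)`, as
`pairRep_wordPermRep_apply`). [folklore] -/
theorem pairRep_wordPermRep_pairRep_apply {N N' D : ℕ} (τ : Equiv.Perm (Fin D))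
    (F : Word N D × (Word N' D × Word N' D) → k) (p : Word N D × (Word N' D × Word N' D)) :
    pairRep (wordPermRep k N D) (pairRep (wordPermRep k N' D) (wordPermRep k N' D)) τ F p =
      F (p.1 ∘ ⇑τ, (p.2.1 ∘ ⇑τ, p.2.2 ∘ ⇑τ)) := by
  classical
  rw [pairRep_apply_apply, Finset.sum_eq_single (p.1 ∘ ⇑τ, (p.2.1 ∘ ⇑τ, p.2.2 ∘ ⇑τ))]
  · rw [wordPermRep_apply, wordPerm_single, pairRep_wordPermRep_apply, pairPermAct_apply]
    have h1 : (p.1 ∘ ⇑τ) ∘ ⇑τ⁻¹ = p.1 := by funext q; simp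
    rw [h1, Pi.single_eq_same, Pi.single_eq_same, mul_one, mul_one]
  · intro q _ hq
    rw [wordPermRep_apply, wordPerm_single, pairRep_wordPermRep_apply, pairPermAct_apply]
    by_cases hq1 : q.1 ∘ ⇑τ⁻¹ = p.1
    · have hq2 : (p.2.1 ∘ ⇑τ, p.2.2 ∘ ⇑τ) ≠ q.2 := by
        intro hq2
        apply hq
        refine Prod.ext ?_ hq2.symm
        rw [← hq1]; funext r; simp
      rw [Pi.single_eq_of_ne hq2, mul_zero, mul_zero]
    · rw [Pi.single_eq_of_ne (Ne.symm hq1), zero_mul, mul_zero]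
  · exact fun h => absurd (Finset.mem_univ _) h

/-- **Gesmundo–Ikenmeyer–Panova's Thm. 8 inequality `t_λ ≤ sm(λ)`, occurrence form (proved).**
If the dual weight `λ*` of a partition `λ ⊢ D` with at most `m²` parts occurs in the coordinate
ring `k[\overline{GL_{m²} · tr(X^n)}]` (degree-`n` coordinates, characteristic zero),
then for some `μ ⊢ D` with at most `m` parts the character sum
`∑_{τ ∈ 𝔖_D} χ^λ(τ) (χ^μ(τ)² + χ^μ(τ²)) = 2 · D! · sk(λ, μ)` is nonzero: "the inclusion
`ℂ[\overline{GL_{n²}Pow_n^m}]_d ⊆ ℂ[GL_{n²}Pow_n^m]_d` of `GL_{n²}`-representations, therefore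
`t_{λ,n}(d[m]) ≤ sm(λ, n)`", `sm(λ, n) = Σ_{μ ⊢_n dm} sk(λ, μ)` (Thm. 8, Thm. 24). See the module
docstring for the proof, an inequality form of GIP §4 on the stabilizing subfamily
`{a ⊗ (a⁻¹)ᵀ} ∪ {τ}`. [cite: GesmundoIkenmeyerPanova2017, Thm. 8 with Thm. 24] -/
theorem exists_sum_ne_zero_of_hasHighestWeight_powFormLex [CharZero k] {n D : ℕ}
    (lam : Nat.Partition D) (hlam : lam.parts.card ≤ m * m)
    (h : HasHighestWeight
      (Literature.Computability.AlgebraicComplexity.orbitCoordRep (powFormLex k m n) n)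
      (Weight.dualOfPartition (m * m) lam).toMatIdx) :
    ∃ μ : Nat.Partition D, μ.parts.card ≤ m ∧
      ∑ τ : Equiv.Perm (Fin D), spechtCharacter k lam τ *
        (spechtCharacter k μ τ ^ 2 + spechtCharacter k μ (τ * τ)) ≠ 0 := by
  classical
  set χ₀ : Weight (Fin (m * m)) := Weight.dualOfPartition (m * m) lam with hχ₀
  -- a nonzero element of the bound space
  obtain ⟨L, hL, hL0⟩ := exists_mem_boundSpace_ne_zero (powFormLex k m n) n
    (χ₀.toMatIdx : Weight (MatIdx m)) (matIdxEquiv m) (size_toMatIdx_dualOfPartition' lam hlam)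
    (powFixed k m D) (IsPowStab k m) (fun x hx => hx) (fun g hg => by
      rcases hg with ⟨a, rfl⟩ | rfl
      · exact linSubstRep_reindexGL_kronFin_powFormLex k m a n
      · exact linSubstRep_reindexGL_swapGL_powFormLex k m n) h
  rw [toMatIdx_comp_matIdxEquiv] at hL
  obtain ⟨hLinv, hLcol, hLrow⟩ := hL
  -- a nonzero row
  obtain ⟨I₀, hI₀⟩ : ∃ I₀, (fun J => L I₀ J) ≠ 0 := by
    by_contra hall
    push Not at hall
    exact hL0 (Matrix.ext fun I J => congr_fun (hall I) J)
  -- the matrices of the rows: symmetric, commuting with `GL_m`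
  set M : Word (m * m) D → Matrix (Word m D) (Word m D) k := fun I => splitMat (fun J => L I J)
    with hM
  have hMc : ∀ I, IsGLCommuting k (M I) := fun I => isGLCommuting_splitMat_of_mem_powFixed (hLrow I)
  have hMt : ∀ I, (M I)ᵀ = M I := fun I => splitMat_transpose_of_mem_powFixed (hLrow I)
  have hM0 : M I₀ ≠ 0 := fun h0 => hI₀ ((splitMat_eq_zero_iff _).mp h0)
  obtain ⟨μ, hμ, x, hx, hMx⟩ := (hMc I₀).exists_mulVec_ne_zero (hMt I₀) hM0
  refine ⟨μ, hμ, ?_⟩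
  -- the invariant element of the slice representation `Y ⊗ Sym²(HW_μ)`
  set Y := transposedWeightSpace k (m * m) D χ₀ with hYdef
  have hY := transposedWeightSpace_le_comap k (D := D) χ₀
  have hHW := highestWeightSpace_le_comap_wordPermRep k (D := D) (Weight.ofPartition m μ)
  have hXμ := symSlice_le_comap (ρ := wordPermRep k m D) hHW
  set Lμ : Word (m * m) D × (Word m D × Word m D) → k :=
    fun p => hwSliceMat μ hμ (M p.1) p.2.1 p.2.2 with hLμ
  have hLμ_mem : Lμ ∈ sliceSubmodule Y (symSlice (hwSpace k m μ)) := by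
    refine ⟨fun q => ?_, fun I => (hMc I).hwSliceMat_mem_symSlice μ hμ (hMt I)⟩
    have hexp : (fun I => Lμ (I, q)) = ∑ w : Word m D,
        hwProjMat k μ hμ w q.2 • fun I => L I ((splitWord m D).symm (q.1, w)) := by
      funext I
      simp only [hLμ, hwSliceMat, Matrix.mul_apply, hM, splitMat_apply, Finset.sum_apply,
        Pi.smul_apply, smul_eq_mul]
      exact Finset.sum_congr rfl fun w _ => mul_comm _ _
    rw [hexp]
    exact Y.sum_mem fun w _ => Y.smul_mem _ (hLcol _)
  have hLμ_inv : ∀ τ : Equiv.Perm (Fin D),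
      pairRep (wordPermRep k (m * m) D) (pairRep (wordPermRep k m D) (wordPermRep k m D)) τ Lμ =
        Lμ := by
    intro τ
    funext p
    rw [pairRep_wordPermRep_pairRep_apply]
    have hMτ : M (p.1 ∘ ⇑τ) = (M p.1).submatrix (compPerm τ⁻¹) (compPerm τ⁻¹) := by
      ext u v
      simp only [hM, splitMat_apply, Matrix.submatrix_apply, compPerm_apply]
      have hI := hLinv.apply_comp τ p.1 ((splitWord m D).symm (u ∘ ⇑τ⁻¹, v ∘ ⇑τ⁻¹))
      rw [splitWord_symm_comp] at hI
      have hu : (u ∘ ⇑τ⁻¹) ∘ ⇑τ = u := by funext q; simp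
      have hv : (v ∘ ⇑τ⁻¹) ∘ ⇑τ = v := by funext q; simp
      rw [hu, hv] at hI
      exact hI
    simp only [hLμ]
    rw [hMτ, hwSliceMat_submatrix_compPerm, Matrix.submatrix_apply, compPerm_apply, compPerm_apply]
    have hu : (p.2.1 ∘ ⇑τ) ∘ ⇑τ⁻¹ = p.2.1 := by funext q; simp
    have hv : (p.2.2 ∘ ⇑τ) ∘ ⇑τ⁻¹ = p.2.2 := by funext q; simp
    rw [hu, hv]
  have hLμ0 : Lμ ≠ 0 := by
    intro h0
    apply hwSliceMat_ne_zero μ hμ hx hMx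
    ext u v
    exact congr_fun h0 (I₀, (u, v))
  -- counting the invariants: `D! · dim = ∑_τ χ^λ(τ) χ_{Sym²}(τ)`
  haveI : Invertible (Nat.card (Equiv.Perm (Fin D)) : k) :=
    invertibleOfNonzero (by
      rw [Nat.card_eq_fintype_card]; exact Nat.cast_ne_zero.mpr Fintype.card_ne_zero)
  have hcount := card_mul_finrank_invariants_sliceRep hY hXμ
  have hfin : Module.finrank k (sliceRep hY hXμ).invariants ≠ 0 := by
    intro h0
    rw [Submodule.finrank_eq_zero] at h0
    have hmem : (⟨Lμ, hLμ_mem⟩ : sliceSubmodule Y (symSlice (hwSpace k m μ))) ∈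
        (sliceRep hY hXμ).invariants := by
      rw [Representation.mem_invariants]
      intro τ
      exact Subtype.ext (hLμ_inv τ)
    rw [h0, Submodule.mem_bot] at hmem
    exact hLμ0 (congrArg Subtype.val hmem)
  have hne : ∑ τ : Equiv.Perm (Fin D), (transposedPermRep k (D := D) χ₀).character τ *
      ((pairRep (wordPermRep k m D) (wordPermRep k m D)).subrepresentation
        (symSlice (hwSpace k m μ)) hXμ).character τ ≠ 0 := by
    intro h0
    have := hcount.trans h0
    exact mul_ne_zero (Invertible.ne_zero _) (Nat.cast_ne_zero.mpr hfin) this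
  rw [hχ₀, character_transposedPermRep_dualOfPartition k lam hlam] at hne
  -- `2 χ_{Sym²}(τ) = χ^μ(τ)² + χ^μ(τ²)`
  have hchar : ((wordPermRep k m D).subrepresentation (hwSpace k m μ) hHW).character =
      spechtCharacter k μ := character_hwPermRep k μ hμ
  intro hsum
  apply hne
  have h2 : (2 : k) ≠ 0 := two_ne_zero
  apply mul_left_cancel₀ h2
  rw [mul_zero, Finset.mul_sum, ← hsum]
  refine Finset.sum_congr rfl fun τ _ => ?_
  rw [mul_left_comm, two_mul_character_symSlice hHW τ, hchar]

end Bound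

end Literature.NumberTheory.DiophantineGeometry
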